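import Literature.NumberTheory.LFunctions.MertensSecondLogPower
import HarnessLib

/-!
# Route `PrimeLevelFamEdge`, crux K_A `MomentsBeyondDiagonal` (stmt-Parity-20007), line «petersson_layers» v4, stub `stub_diag`:
# **Mertens' theorem for `log² p`: `Σ_{p ≤ x} log²p/p = ½log²x + κ + O((log x)⁻ⁿ)` with its constant**

Second brick (L2) of the ONE new analytic input (P2TAIL) of the order-`(2,2)` remainder estimate of `stub_diag` (the asymptotic
with rate of the `P₂`-decorated Selberg coefficients; plan in `Cruxes/MomentsBeyondDiagonal/Lines/petersson_layers_stub_diag_g12_R02_R22.md`).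
It is the prime-sum input of `Σ_{d ≤ y} μ(d)P₂(d)/d = −log y + c + O(…)` (`μP₂/id = (μ/id) ∗ (g/id)`, `g(pʲ) = −log²p`).
Partial summation from `ϑ` exactly as in the tree's `…Mertens.primeLogDivSum_eq_theta_add_integral` / `mertensTau_eq` /
`abs_mertensTau_sub_const_le` (p. Mertens' first theorem), one `log` higher:

* `primeLogSqDivSum_eq_theta_add_integral` — `Σ_{p ≤ x} log²p/p = ϑ(x)log x/x + ∫_2^x ϑ(t)(log t − 1) dt/t²` (`x ≥ 2`);
* `primeLogSqDivSum_eq` — `= ½log²x + (log 2 − ½log²2) + (ϑ(x) − x)log x/x + ∫_2^x (ϑ(t) − t)(log t − 1) dt/t²`;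
* `integrableOn_theta_sub_mul_log_div_sq` — `(ϑ(t) − t)(log t − 1)/t²` is integrable on `(2, ∞)` (PNT);
* `abs_primeLogSqDivSum_sub_le` — **for every `n` there is `K` with
  `|Σ_{p ≤ x} log²p/p − ½log²x − κ| ≤ K/(log x)ⁿ` (`x ≥ 2`), `κ = log 2 − ½log²2 + ∫_2^∞ (ϑ(t) − t)(log t − 1) dt/t²`.**

Def-free; theorems only; classical (Montgomery–Vaughan Thm 2.7 with the error term of Thm 6.9; the tree's PROVED prime number
theorem `…Mertens.exists_abs_theta_sub_le_div_log_pow`). Helper `--supports stmt-Parity-20007`; closes nothing; K_A, K_B and the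
Parity summit are NOT proved; nothing about Landau–Siegel zeros.

## References
* H. L. Montgomery, R. C. Vaughan, *Multiplicative Number Theory I*, CUP 2007, Thm 2.7 (b) and §6.2 (Thm 6.9 and the remark after it).
  [cite: MontgomeryVaughan2007, Thm 2.7 (b) and §6.2 — derivation (one log higher)]
-/

noncomputable section

open Filter Topology Set MeasureTheory Finset Real
open scoped Chebyshev

namespace Summit.Parity.GeneralizedHardyLittlewood.Theorems.MomentsBeyondDiagonal.DiagCorner

open Literature.NumberTheory.LFunctions.Mertens

/-- **Partial summation**: for `x ≥ 2`, `Σ_{p ≤ x} log²p/p = ϑ(x) log x/x + ∫_2^x ϑ(t)(log t − 1) dt/t²`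
(`f(t) = log t/t`, `f′(t) = (1 − log t)/t²`). [cite: MontgomeryVaughan2007, Thm 2.7 (b), proof — derivation] -/
theorem primeLogSqDivSum_eq_theta_add_integral {x : ℝ} (hx : 2 ≤ x) :
    ∑ p ∈ Nat.primesLE ⌊x⌋₊, Real.log p ^ 2 / p =
      θ x * Real.log x / x + ∫ t in Ioc 2 x, θ t * (Real.log t - 1) / t ^ 2 := by
  set c : ℕ → ℝ := fun k => if k.Prime then Real.log k else 0 with hc
  set f : ℝ → ℝ := fun t => Real.log t * t⁻¹ with hf
  have hS : ∀ t : ℝ, ∑ k ∈ Icc 0 ⌊t⌋₊, c k = θ t := fun t ↦ by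
    rw [Chebyshev.theta_eq_sum_Icc, Finset.sum_filter]
  have hf_has : ∀ t : ℝ, 0 < t → HasDerivAt f ((1 - Real.log t) / t ^ 2) t := by
    intro t ht
    have h := (Real.hasDerivAt_log ht.ne').mul (hasDerivAt_inv ht.ne')
    refine h.congr_deriv ?_
    field_simp
    ring
  have hf_diff : ∀ t ∈ Set.Icc 2 x, DifferentiableAt ℝ f t := fun t ht =>
    (hf_has t (by linarith [ht.1])).differentiableAt
  have hderiv_eq : ∀ t ∈ Set.Icc 2 x, deriv f t = (1 - Real.log t) / t ^ 2 := fun t ht =>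
    (hf_has t (by linarith [ht.1])).deriv
  have hg_cont : ContinuousOn (fun t : ℝ ↦ (1 - Real.log t) / t ^ 2) (Set.Icc 2 x) := by
    refine ContinuousOn.div (continuousOn_const.sub (Real.continuousOn_log.mono ?_)) (continuousOn_pow 2) ?_
    · intro t ht
      exact Set.mem_compl_singleton_iff.mpr (show (0 : ℝ) < t by linarith [ht.1]).ne'
    · intro t ht; exact pow_ne_zero _ (show t ≠ 0 by linarith [ht.1])
  have hf_int : IntegrableOn (deriv f) (Set.Icc 2 x) :=
    hg_cont.integrableOn_Icc.congr_fun (fun t ht => (hderiv_eq t ht).symm) measurableSet_Icc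
  have habel := sum_mul_eq_sub_sub_integral_mul c (by norm_num : (0 : ℝ) ≤ 2) hx hf_diff hf_int
  have hfl2 : ⌊(2 : ℝ)⌋₊ = 2 := by norm_num
  have hfc : ∀ k : ℕ, f k * c k = if k.Prime then Real.log k ^ 2 / k else 0 := by
    intro k
    simp only [hf, hc]
    split_ifs with hk
    · rw [div_eq_mul_inv]; ring
    · simp
  have hsum : ∀ n : ℕ, ∑ k ∈ Ioc 0 n, f k * c k = ∑ p ∈ Nat.primesLE n, Real.log p ^ 2 / p := by
    intro n
    rw [Nat.primesLE_eq_filter_Ioc_zero, Finset.sum_filter]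
    exact Finset.sum_congr rfl fun k _ ↦ hfc k
  have hx2 : 2 ≤ ⌊x⌋₊ := Nat.le_floor (by simpa using hx)
  have hlhs : ∑ k ∈ Ioc ⌊(2 : ℝ)⌋₊ ⌊x⌋₊, f k * c k =
      (∑ p ∈ Nat.primesLE ⌊x⌋₊, Real.log p ^ 2 / p) - Real.log 2 ^ 2 / 2 := by
    rw [hfl2, ← hsum, eq_sub_iff_add_eq, add_comm,
      Finset.sum_Ioc_consecutive _ (Nat.zero_le 2) hx2 |>.symm]
    congr 1
    rw [show Finset.Ioc 0 2 = {1, 2} by decide, Finset.sum_pair (by norm_num), hfc, hfc]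
    norm_num [Nat.prime_two, Nat.not_prime_one]
  have hb2 : f 2 * ∑ k ∈ Icc 0 ⌊(2 : ℝ)⌋₊, c k = Real.log 2 ^ 2 / 2 := by
    rw [hS, hf]
    have : θ (2 : ℝ) = Real.log 2 := by
      rw [show (2 : ℝ) = ((2 : ℕ) : ℝ) by norm_num, Chebyshev.theta_eq_sum_primesLE_log,
        primesLE_two, Finset.sum_singleton]
    rw [this]
    ring
  have hbx : f x * ∑ k ∈ Icc 0 ⌊x⌋₊, c k = θ x * Real.log x / x := by
    rw [hS, hf]
    ring
  have hint : ∫ t in Set.Ioc 2 x, deriv f t * ∑ k ∈ Icc 0 ⌊t⌋₊, c k =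
      -∫ t in Ioc 2 x, θ t * (Real.log t - 1) / t ^ 2 := by
    rw [← integral_neg]
    refine setIntegral_congr_fun measurableSet_Ioc fun t ht ↦ ?_
    rw [hderiv_eq t (Set.Ioc_subset_Icc_self ht), hS]
    ring
  rw [hlhs, hb2, hbx, hint] at habel
  linarith

/-- `(ϑ(t) − t)(log t − 1)/t²` is integrable on every `(2, x]` (bounded by `3(log x + 1)/2`, measurable). [folklore] -/
theorem integrableOn_theta_sub_mul_log_div_sq_Ioc (x : ℝ) :
    IntegrableOn (fun t : ℝ ↦ (θ t - t) * (Real.log t - 1) / t ^ 2) (Ioc 2 x) := by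
  have hmeas : Measurable fun t : ℝ ↦ (θ t - t) * (Real.log t - 1) / t ^ 2 :=
    ((measurable_theta.sub measurable_id).mul (Real.measurable_log.sub measurable_const)).div
      (measurable_id.pow_const 2)
  refine Integrable.mono' (g := fun _ ↦ (3 * (Real.log x + 1) / 2 : ℝ)) (integrableOn_const (by simp))
    hmeas.aestronglyMeasurable ?_
  rw [ae_restrict_iff' measurableSet_Ioc]
  refine Eventually.of_forall fun t ht ↦ ?_
  have ht2 : (2 : ℝ) < t := ht.1
  have htx : t ≤ x := ht.2
  have ht0 : 0 < t := by linarith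
  have hlt0 : 0 ≤ Real.log t := Real.log_nonneg (by linarith)
  have hltx : Real.log t ≤ Real.log x := Real.log_le_log ht0 htx
  have hth := abs_theta_sub_self_le ht0.le
  have hl1 : |Real.log t - 1| ≤ Real.log x + 1 := by
    rw [abs_le]; constructor <;> linarith
  rw [Real.norm_eq_abs, abs_div, abs_of_pos (by positivity : (0 : ℝ) < t ^ 2), div_le_iff₀ (by positivity),
    abs_mul]
  calc |θ t - t| * |Real.log t - 1| ≤ 3 * t * (Real.log x + 1) :=
        mul_le_mul hth hl1 (abs_nonneg _) (by positivity)
    _ ≤ 3 * (Real.log x + 1) / 2 * t ^ 2 := by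
        have h2t : 2 * t ≤ t ^ 2 := by nlinarith
        have hL : 0 ≤ 3 * (Real.log x + 1) / 2 := by
          have hlx : 0 ≤ Real.log x := hlt0.trans hltx
          linarith
        nlinarith [mul_le_mul_of_nonneg_left h2t hL]

/-- **The exact formula**: for `x ≥ 2`,
`Σ_{p ≤ x} log²p/p = ½log²x + (log 2 − ½log²2) + (ϑ(x) − x) log x/x + ∫_2^x (ϑ(t) − t)(log t − 1) dt/t²`
(`∫_2^x (log t − 1) dt/t = ½log²x − log x − ½log²2 + log 2`). [cite: MontgomeryVaughan2007, Thm 2.7 (b), proof — derivation] -/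
theorem primeLogSqDivSum_eq {x : ℝ} (hx : 2 ≤ x) :
    ∑ p ∈ Nat.primesLE ⌊x⌋₊, Real.log p ^ 2 / p =
      Real.log x ^ 2 / 2 + (Real.log 2 - Real.log 2 ^ 2 / 2) + (θ x - x) * Real.log x / x +
        ∫ t in Ioc 2 x, (θ t - t) * (Real.log t - 1) / t ^ 2 := by
  rw [primeLogSqDivSum_eq_theta_add_integral hx]
  have hx0 : 0 < x := by linarith
  -- `∫_2^x (log t - 1)/t dt`
  have h1 : IntegrableOn (fun t : ℝ ↦ (Real.log t - 1) * t⁻¹) (Ioc 2 x) := by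
    refine (ContinuousOn.mul ((Real.continuousOn_log.mono ?_).sub continuousOn_const)
      ((continuousOn_inv₀ (G₀ := ℝ)).mono ?_)).integrableOn_Icc.mono_set Set.Ioc_subset_Icc_self
    · intro t ht
      exact Set.mem_compl_singleton_iff.mpr (show (0 : ℝ) < t by linarith [ht.1]).ne'
    · intro t ht
      exact Set.mem_compl_singleton_iff.mpr (show (0 : ℝ) < t by linarith [ht.1]).ne'
  have hsplit : ∀ t ∈ Ioc 2 x, θ t * (Real.log t - 1) / t ^ 2 =
      (θ t - t) * (Real.log t - 1) / t ^ 2 + (Real.log t - 1) * t⁻¹ := by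
    intro t ht
    have ht0 : t ≠ 0 := by linarith [ht.1]
    field_simp
    ring
  rw [setIntegral_congr_fun measurableSet_Ioc hsplit,
    integral_add (integrableOn_theta_sub_mul_log_div_sq_Ioc x) h1]
  have hderiv : ∀ t ∈ Set.uIcc 2 x, HasDerivAt (fun t : ℝ ↦ Real.log t ^ 2 / 2 - Real.log t)
      ((Real.log t - 1) * t⁻¹) t := by
    intro t ht
    rw [Set.uIcc_of_le hx] at ht
    have ht0 : t ≠ 0 := by linarith [ht.1]
    have hl := Real.hasDerivAt_log ht0
    have h := ((hl.pow 2).div_const 2).sub hl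
    refine h.congr_deriv ?_
    simp only [Nat.cast_ofNat]
    ring
  have hcont : ContinuousOn (fun t : ℝ ↦ (Real.log t - 1) * t⁻¹) (Set.uIcc 2 x) := by
    rw [Set.uIcc_of_le hx]
    refine ContinuousOn.mul ((Real.continuousOn_log.mono ?_).sub continuousOn_const)
      ((continuousOn_inv₀ (G₀ := ℝ)).mono ?_)
    · intro t ht
      exact Set.mem_compl_singleton_iff.mpr (show (0 : ℝ) < t by linarith [ht.1]).ne'
    · intro t ht
      exact Set.mem_compl_singleton_iff.mpr (show (0 : ℝ) < t by linarith [ht.1]).ne'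
  have hinv : ∫ t in Ioc 2 x, (Real.log t - 1) * t⁻¹ =
      (Real.log x ^ 2 / 2 - Real.log x) - (Real.log 2 ^ 2 / 2 - Real.log 2) := by
    rw [← intervalIntegral.integral_of_le hx]
    exact intervalIntegral.integral_eq_sub_of_hasDerivAt hderiv (hcont.intervalIntegrable)
  rw [hinv]
  field_simp
  ring

/-- `(ϑ(t) − t)(log t − 1)/t²` is integrable on `(2, ∞)`: it is `O(1/(t log² t))` by the prime number theorem
(`|ϑ(t) − t| ≤ Ct/log³t`, `|log t − 1| ≤ 3 log t` for `t > 2`). [folklore] -/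
theorem integrableOn_theta_sub_mul_log_div_sq :
    IntegrableOn (fun t : ℝ ↦ (θ t - t) * (Real.log t - 1) / t ^ 2) (Ioi 2) := by
  obtain ⟨C, hC0, hC⟩ := exists_abs_theta_sub_le_div_log_pow 3
  have hmeas : Measurable fun t : ℝ ↦ (θ t - t) * (Real.log t - 1) / t ^ 2 :=
    ((measurable_theta.sub measurable_id).mul (Real.measurable_log.sub measurable_const)).div
      (measurable_id.pow_const 2)
  refine Integrable.mono' (integrableOn_inv_div_log_sq.const_mul (3 * C)) hmeas.aestronglyMeasurable ?_
  rw [ae_restrict_iff' measurableSet_Ioi]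
  refine Eventually.of_forall fun t ht ↦ ?_
  have ht2 : (2 : ℝ) < t := ht
  have ht0 : 0 < t := by linarith
  have hl2 : (1 : ℝ) / 2 < Real.log 2 := by
    have := Real.log_two_gt_d9; linarith
  have hl : Real.log 2 < Real.log t := Real.log_lt_log two_pos ht2
  have hlpos : 0 < Real.log t := by linarith
  have hl1 : |Real.log t - 1| ≤ 3 * Real.log t := by
    rw [abs_le]; constructor <;> linarith
  rw [Real.norm_eq_abs, abs_div, abs_of_pos (by positivity : (0 : ℝ) < t ^ 2), div_le_iff₀ (by positivity),
    abs_mul]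
  calc |θ t - t| * |Real.log t - 1| ≤ C * t / Real.log t ^ 3 * (3 * Real.log t) :=
        mul_le_mul (hC t ht2.le) hl1 (abs_nonneg _) (by positivity)
    _ = 3 * C * (t⁻¹ / Real.log t ^ 2) * t ^ 2 := by
        field_simp

/-- For `x ≥ 2`: `Σ_{p ≤ x} log²p/p − ½log²x − κ = (ϑ(x) − x)log x/x − ∫_x^∞ (ϑ(t) − t)(log t − 1) dt/t²`,
`κ = log 2 − ½log²2 + ∫_2^∞ (ϑ(t) − t)(log t − 1) dt/t²`. [folklore] -/
theorem primeLogSqDivSum_sub_eq {x : ℝ} (hx : 2 ≤ x) :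
    (∑ p ∈ Nat.primesLE ⌊x⌋₊, Real.log p ^ 2 / p) - Real.log x ^ 2 / 2 -
        (Real.log 2 - Real.log 2 ^ 2 / 2 + ∫ t in Ioi 2, (θ t - t) * (Real.log t - 1) / t ^ 2) =
      (θ x - x) * Real.log x / x - ∫ t in Ioi x, (θ t - t) * (Real.log t - 1) / t ^ 2 := by
  have hI := integrableOn_theta_sub_mul_log_div_sq
  have hsplit : ∫ t in Ioi 2, (θ t - t) * (Real.log t - 1) / t ^ 2 =
      (∫ t in Ioc 2 x, (θ t - t) * (Real.log t - 1) / t ^ 2) + ∫ t in Ioi x, (θ t - t) * (Real.log t - 1) / t ^ 2 := by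
    rw [← setIntegral_union (Set.Ioc_disjoint_Ioi le_rfl) measurableSet_Ioi
      (hI.mono_set Ioc_subset_Ioi_self) (hI.mono_set (Ioi_subset_Ioi hx)),
      Ioc_union_Ioi_eq_Ioi hx]
  rw [hsplit, primeLogSqDivSum_eq hx]
  ring

/-- **Mertens' theorem for `log² p` with its constant and a log-power error term**: for every `n` there is `K` with
`|Σ_{p ≤ x} log²p/p − ½log²x − κ| ≤ K/(log x)ⁿ` for all `x ≥ 2`, `κ = log 2 − ½log²2 + ∫_2^∞ (ϑ(t) − t)(log t − 1) dt/t²`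
(from `|ϑ(x) − x| ≤ Cx/(log x)^{n+3}`). [cite: MontgomeryVaughan2007, Thm 2.7 (b) and §6.2 — derivation (one log higher)] -/
theorem abs_primeLogSqDivSum_sub_le (n : ℕ) :
    ∃ K : ℝ, ∀ x : ℝ, 2 ≤ x →
      |(∑ p ∈ Nat.primesLE ⌊x⌋₊, Real.log p ^ 2 / p) - Real.log x ^ 2 / 2 -
          (Real.log 2 - Real.log 2 ^ 2 / 2 + ∫ t in Ioi 2, (θ t - t) * (Real.log t - 1) / t ^ 2)| ≤
        K / Real.log x ^ n := by
  obtain ⟨C, hC0, hC⟩ := exists_abs_theta_sub_le_div_log_pow (n + 3)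
  have hl2 : 0 < Real.log 2 := Real.log_pos one_lt_two
  have hl2' : (1 : ℝ) / 2 < Real.log 2 := by
    have := Real.log_two_gt_d9; linarith
  refine ⟨C / Real.log 2 ^ 2 + 3 * C / Real.log 2, fun x hx ↦ ?_⟩
  have hx1 : 1 < x := by linarith
  have hx0 : 0 < x := by linarith
  have hl : 0 < Real.log x := Real.log_pos hx1
  have hl2x : Real.log 2 ≤ Real.log x := Real.log_le_log two_pos hx
  rw [primeLogSqDivSum_sub_eq hx]
  -- the boundary term
  have h1 : |(θ x - x) * Real.log x / x| ≤ C / Real.log 2 ^ 2 / Real.log x ^ n := by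
    rw [abs_div, abs_of_pos hx0, div_le_iff₀ hx0, abs_mul, abs_of_pos hl]
    calc |θ x - x| * Real.log x ≤ C * x / Real.log x ^ (n + 3) * Real.log x :=
          mul_le_mul_of_nonneg_right (hC x hx) hl.le
      _ = C / Real.log x ^ 2 / Real.log x ^ n * x := by
          have hlne : Real.log x ≠ 0 := hl.ne'
          field_simp
          ring
      _ ≤ C / Real.log 2 ^ 2 / Real.log x ^ n * x := by gcongr
  -- the tail integral, in the format of `abs_integral_Ioi_mul_inv_div_log_pow_le`
  have hcongr : ∫ t in Ioi x, (θ t - t) * (Real.log t - 1) / t ^ 2 =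
      ∫ t in Ioi x, ((θ t - t) * (Real.log t - 1) * Real.log t ^ 2 / t) * (t⁻¹ / Real.log t ^ (0 + 2)) := by
    refine setIntegral_congr_fun measurableSet_Ioi fun t ht ↦ ?_
    have hxt : x < t := ht
    have ht0 : t ≠ 0 := by linarith
    have hlt : Real.log t ≠ 0 := (Real.log_pos (hx1.trans hxt)).ne'
    field_simp
    ring
  have hh : ∀ t : ℝ, x < t → |(θ t - t) * (Real.log t - 1) * Real.log t ^ 2 / t| ≤ 3 * C / Real.log t ^ n := by
    intro t hxt
    have ht2 : 2 < t := lt_of_le_of_lt hx hxt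
    have ht0 : 0 < t := by linarith
    have hlt2 : Real.log 2 < Real.log t := Real.log_lt_log two_pos ht2
    have hlt : 0 < Real.log t := by linarith
    have hl1 : |Real.log t - 1| ≤ 3 * Real.log t := by
      rw [abs_le]; constructor <;> linarith
    rw [abs_div, abs_of_pos ht0, div_le_iff₀ ht0, abs_mul, abs_mul, abs_of_pos (by positivity : 0 < Real.log t ^ 2)]
    calc |θ t - t| * |Real.log t - 1| * Real.log t ^ 2 ≤ C * t / Real.log t ^ (n + 3) * (3 * Real.log t) * Real.log t ^ 2 := by
          gcongr
          exact hC t ht2.le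
      _ = 3 * C / Real.log t ^ n * t := by
          have hlne : Real.log t ≠ 0 := hlt.ne'
          field_simp
          ring
  have h2 : |∫ t in Ioi x, (θ t - t) * (Real.log t - 1) / t ^ 2| ≤ 3 * C / Real.log 2 / Real.log x ^ n := by
    rw [hcongr]
    have h := abs_integral_Ioi_mul_inv_div_log_pow_le (h := fun t ↦ (θ t - t) * (Real.log t - 1) * Real.log t ^ 2 / t)
      hx1 n 0 (by positivity : 0 ≤ 3 * C) hh
    have hle : 3 * C / Real.log x ^ (n + 0 + 1) ≤ 3 * C / Real.log 2 / Real.log x ^ n := by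
      rw [show n + 0 + 1 = n + 1 by ring, div_div]
      apply div_le_div_of_nonneg_left (by positivity) (by positivity)
      rw [pow_succ]
      have hp : 0 ≤ Real.log x ^ n := by positivity
      nlinarith
    exact h.trans hle
  calc |(θ x - x) * Real.log x / x - ∫ t in Ioi x, (θ t - t) * (Real.log t - 1) / t ^ 2|
      ≤ |(θ x - x) * Real.log x / x| + |∫ t in Ioi x, (θ t - t) * (Real.log t - 1) / t ^ 2| := abs_sub _ _
    _ ≤ C / Real.log 2 ^ 2 / Real.log x ^ n + 3 * C / Real.log 2 / Real.log x ^ n := add_le_add h1 h2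
    _ = (C / Real.log 2 ^ 2 + 3 * C / Real.log 2) / Real.log x ^ n := by ring

end Summit.Parity.GeneralizedHardyLittlewood.Theorems.MomentsBeyondDiagonal.DiagCorner

end
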